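/-
Copyright: statement-level skeleton of a published paper (lit-balaban cell, Phase-2 proof seat p37 gen 106). No claims beyond
what the kernel checks below.
-/
import Literature.MathematicalPhysics.QuantumFieldTheory.Balaban1983to89.B3OnePIGraphs
import Literature.MathematicalPhysics.QuantumFieldTheory.Balaban1983to89.B3GraphGlueLegs

/-!
# B3 — T. Bałaban, *(Higgs)₂,₃ quantum fields in a finite volume. III. Renormalization*, CMP **88** (1983) 411–445
[Balaban1983Higgs3] — p. 416 [PDF 6] (1.21) `G^ε = Σ_n C₀^ε[X C₀^ε]ⁿ`: the GLUE CONSTRUCTOR on the concrete graph model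
`B3Cor23Concrete.Graph` (p18) — two graphs of the model joined by ONE NEW INTERNAL LINE between a chosen external leg of each
are a graph of the model; the glued graph is connected iff both pieces are; the new line SEPARATES the two pieces, so the glued
graph is never one-particle-irreducible, and it is not proper as soon as each piece keeps another external leg (the converse,
constructive direction of the bridge lemma `B3OnePIBridge`: the model side of "a term of [X C₀^ε]ⁿ, n ≥ 2, is a connected,
one-particle-REDUCIBLE graph")

statement-level skeleton of published theorems with citation tags; proofs where landed; nothing here is a claim about
the Yang–Mills mass gap

PDF held: `paper:balaban1983-higgs-2-3-quantum-fields-finite-volume` (journal page = PDF page + 410); pp. 414–416 read in the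
text layer (`p0004.txt`–`p0006.txt` of `lit read`) and on the ×2 renders `run/shared/lean/pub/pub-balaban/b2b-balaban-ref1/pages/
1983-cmp88-higgs23-III/1983-cmp88-higgs23-III-p004, p005, p006-x2.png`.

CITATION HEADER (lean-in-tree rule).  lit-balaban TYPED SKELETON (HOME `run/shared/lean/pub/lit-balaban/`), PHASE 2, seat p37
gen 106 (unit `lit-balaban-p37`; TAKING line HOME/STATUS.md 2026-08-23, FILE F of BRICK 3), for row **B3.Eq1.19-1.22** of
`HOME/lit-balaban-r15/ROWS-B3.md` (fold owner r15, referee ref-4; lead g12 HEAD WORD Q25 2026-08-23T08:24:18Z: bricks WELCOME as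
located members, zero head weight).  Siblings (same seat): `B3OnePIGraphs` (`Adj`, `AdjOff`, `IsConnected`, `IsConnectedOff`,
`IsOnePI`, `IsProper`, `not_reflTransGen_of_closed`), `B3OnePIBridge` (a separating line of a connected graph is a bridge),
`B3OnePIBridgeOrder`, `B3OnePIDecide`, `B3GraphGlueLegs` (§1–§2 of this construction).  p32 g41's `B3Eq121OnePIChains` indexes the terms of (1.21) by LISTS of insertions
abstractly (*"If your … (chain ↦ model graph) happens, my `chainAmp`/`chainDeg` on `List ι` are the natural client"*, p32 →
p37 2026-08-23T08:34:34Z); this file is the two-piece glue on the model, iterated over lists in the sibling `B3OnePIChainGlue`.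
REUSED BY NAME, nothing re-declared: p18's `B3Cor23Concrete.Graph`/`Leg` (fields `other_ne`, `other_symm`, `other_isLeft`,
`exists_line`, `adm`, `numExtLegs_eq_card`), `B3OnePIGraphs.Adj`/`AdjOff`/`adj_iff`/`adjOffOf_iff`/`IsConnected`/`IsConnectedOff`/`IsOnePI`/
`IsProper`/`isConnected_of_root`/`not_reflTransGen_of_closed`, `B3GraphGlueLegs.legL`/`legR`/`glueOther` (+ lemmas).

THE PRINTED TEXT (verbatim).  p. 414: *"… they are divided into pairs and each pair is replaced by the corresponding
propagator."*  p. 415: *"Now a graph for us is a collection of internal lines, external legs, and vertices connected in the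
usual sense. There is at least one internal line, and every internal line has a vertex at each endpoint. The construction of
graphs is otherwise arbitrary."*  p. 416: *"G^ε = Σ_{n=0}^∞ C₀^ε[(−δm² + Σ^ε + ∂^{ε*}Σ₁^ε + Σ₁^{ε*}∂^ε + ∂^{ε*}Σ₂^ε∂^ε)C₀^ε]ⁿ, (1.21)
where C₀^ε = (−Δ₀^ε + m²)^{−1} and Σ^ε, Σ₁^ε, Σ₂^ε are given by amputated, one-particle-irreducible graphs of the expansion of G^ε."*
(The n-th term joins n insertions by n − 1 internal C₀^ε-lines — scalar lines between φ′-legs; print states this structure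
without proof.  What is built here is the elementary operation it iterates: joining two graphs by one new line.)

KIND «(ours)» (G.5-54): the constructions below are OUR plumbing ∕ dictionary on p18's model — print provenance is claimed only for the
sentences quoted above; each declaration's cite tag locates the printed notion it serves (legs (1.17) p. 415, lines ∕ chains (1.21) p. 416).
WHAT IS TYPED / PROVED (definitions with bodies + kernel theorems; no `Prop` fact, no `sorry`; standard axioms).
§1–§2 (the leg equivalence `legEquiv : Leg k₁ ⊕ Leg k₂ ≃ Leg (Fin.append k₁ k₂)`, the glued line data `glueOther` with its computation
rules and field laws) are the sibling `B3GraphGlueLegs` (same seat), imported.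
§3 THE GLUED GRAPH **`glue G₁ G₂ a b ha hb hab : Graph n̄`** for `G₁ G₂ : Graph n̄`, external legs `a` of `G₁`, `b` of `G₂`
(`ha : G₁.other a = none`, `hb : G₂.other b = none`) of the same species (`hab : a.2.isLeft = b.2.isLeft`; in (1.21) both are
φ′-legs): `nV = G₁.nV + G₂.nV`, `kind = Fin.append`, admissibility inherited, `other = glueOther`, at least one line (the new one).
§4 ADJACENCY AND THE THEOREMS.  `adj_glue_left`/`adj_glue_right` (old adjacencies persist), `adj_glue_new` (the new line joins
`a.1` and `b.1`), `adj_glue_cases` (and there is nothing else); **`isConnected_glue`** (both pieces connected ⇒ the glued graph is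
connected), **`isConnected_of_glue_left`/`_right`** (and conversely, by projecting paths onto a piece), **`isConnected_glue_iff`**;
**`not_reflTransGen_adjOff_glue`** (after cutting the new line no path leads from the first piece to the second: the vertex set of
the first piece is closed), **`not_isConnectedOff_glue`**, **`not_isOnePI_glue`** (a glued graph is one-particle REDUCIBLE),
**`not_isProper_glue`** (if each piece keeps a further external leg, the new line separates those two legs).
§5 EXTERNAL LEGS.  `filter_glue_other_eq_none` (the external legs of the glued graph are the old external legs other than `a`,
`b`), **`numExtLegs_glue`**: `numExtLegs (glue …) + 2 = numExtLegs G₁ + numExtLegs G₂` (p18's count `Graph.numExtLegs`).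
HONEST SCOPE.  The two-piece glue and its graph-theoretic properties only; the iteration over lists (chains of n insertions) is
the sibling `B3OnePIChainGlue`; no amplitude is attached (p26's `B3GraphAmplitude` is the evaluator), no degree bookkeeping
((2.2) additivity under glue is not computed here), nothing analytic.
-/

namespace Literature.MathematicalPhysics.QuantumFieldTheory.Balaban1983to89.B3GraphGlue

open Relation B3Prop1 B3Cor23Concrete B3OnePIGraphs B3GraphGlueLegs

/-! ## §3 The glued graph -/

section Glue

variable {nbar : ℕ}

/-- **The glue of two graphs of the model along one new internal line** between the external leg `a` of `G₁` and the external
leg `b` of `G₂` (same species; in (1.21) both are φ′-legs and the new line is a propagator C₀^ε): vertices = those of `G₁` then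
those of `G₂` (`Fin.append`), admissibility inherited, lines = the old lines of both and the new line a—b.  p. 415: *"The
construction of graphs is otherwise arbitrary."* [cite: Balaban1983Higgs3, (1.21) p.416] -/
abbrev glue (G₁ G₂ : Graph nbar) (a : Leg G₁.kind) (b : Leg G₂.kind) (ha : G₁.other a = none) (hb : G₂.other b = none)
    (hab : a.2.isLeft = b.2.isLeft) : Graph nbar where
  nV := G₁.nV + G₂.nV
  kind := Fin.append G₁.kind G₂.kind
  adm v := by
    induction v using Fin.addCases with
    | left i => rw [Fin.append_left]; exact G₁.adm i
    | right j => rw [Fin.append_right]; exact G₂.adm j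
  other := glueOther G₁.other G₂.other a b
  other_ne := glueOther_ne ha hb G₁.other_ne G₂.other_ne
  other_symm := glueOther_symm ha hb G₁.other_symm G₂.other_symm
  other_isLeft := glueOther_isLeft hab G₁.other_isLeft G₂.other_isLeft
  exists_line := ⟨legL G₁.kind G₂.kind a, by simp⟩

variable {G₁ G₂ : Graph nbar} {a : Leg G₁.kind} {b : Leg G₂.kind} {ha : G₁.other a = none} {hb : G₂.other b = none}
  {hab : a.2.isLeft = b.2.isLeft}

/-- kernel: the number of vertices of the glued graph. [cite: Balaban1983Higgs3, (1.21) p.416] -/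
theorem glue_nV : (glue G₁ G₂ a b ha hb hab).nV = G₁.nV + G₂.nV := rfl

/-- kernel: the vertex kinds of the glued graph. [cite: Balaban1983Higgs3, (1.21) p.416] -/
theorem glue_kind : (glue G₁ G₂ a b ha hb hab).kind = Fin.append G₁.kind G₂.kind := rfl

/-- kernel: the lines of the glued graph. [cite: Balaban1983Higgs3, (1.21) p.416] -/
theorem glue_other : (glue G₁ G₂ a b ha hb hab).other = glueOther G₁.other G₂.other a b := rfl

/-! ## §4 Adjacency in the glued graph; connectedness; the new line separates -/

/-- kernel: an adjacency of the first piece persists in the glued graph. [cite: Balaban1983Higgs3, (1.21) p.416] -/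
theorem adj_glue_left {i i' : Fin G₁.nV} (h : Adj G₁ i i') :
    Adj (glue G₁ G₂ a b ha hb hab) (Fin.castAdd G₂.nV i) (Fin.castAdd G₂.nV i') := by
  obtain ⟨x, y, hxy, rfl, rfl⟩ := adj_iff.1 h
  have hxa : x ≠ a := by rintro rfl; rw [ha] at hxy; simp at hxy
  exact adj_iff.2 ⟨legL _ _ x, legL _ _ y, by simp [glueOther_legL_of_ne hxa, hxy], rfl, rfl⟩

/-- kernel: an adjacency of the second piece persists in the glued graph. [cite: Balaban1983Higgs3, (1.21) p.416] -/
theorem adj_glue_right {j j' : Fin G₂.nV} (h : Adj G₂ j j') :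
    Adj (glue G₁ G₂ a b ha hb hab) (Fin.natAdd G₁.nV j) (Fin.natAdd G₁.nV j') := by
  obtain ⟨x, y, hxy, rfl, rfl⟩ := adj_iff.1 h
  have hxb : x ≠ b := by rintro rfl; rw [hb] at hxy; simp at hxy
  exact adj_iff.2 ⟨legR _ _ x, legR _ _ y, by simp [glueOther_legR_of_ne hxb, hxy], rfl, rfl⟩

/-- kernel: the new line makes the vertex of `a` and the vertex of `b` adjacent. [cite: Balaban1983Higgs3, (1.21) p.416] -/
theorem adj_glue_new : Adj (glue G₁ G₂ a b ha hb hab) (Fin.castAdd G₂.nV a.1) (Fin.natAdd G₁.nV b.1) :=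
  adj_iff.2 ⟨legL _ _ a, legR _ _ b, by simp, rfl, rfl⟩

/-- kernel: there is no other adjacency — an adjacency of the glued graph is an old one of either piece or the new line.
[cite: Balaban1983Higgs3, (1.21) p.416] -/
theorem adj_glue_cases {v w : Fin (G₁.nV + G₂.nV)} (h : Adj (glue G₁ G₂ a b ha hb hab) v w) :
    (∃ i i', v = Fin.castAdd G₂.nV i ∧ w = Fin.castAdd G₂.nV i' ∧ Adj G₁ i i') ∨
    (∃ j j', v = Fin.natAdd G₁.nV j ∧ w = Fin.natAdd G₁.nV j' ∧ Adj G₂ j j') ∨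
    (v = Fin.castAdd G₂.nV a.1 ∧ w = Fin.natAdd G₁.nV b.1) ∨ (v = Fin.natAdd G₁.nV b.1 ∧ w = Fin.castAdd G₂.nV a.1) := by
  obtain ⟨z, z', hzz', rfl, rfl⟩ := adj_iff.1 h
  rw [glue_other] at hzz'
  rcases exists_legL_or_legR G₁.kind G₂.kind z with ⟨x, rfl⟩ | ⟨y, rfl⟩
  · by_cases hx : x = a
    · subst hx
      rw [glueOther_legL_self] at hzz'
      cases hzz'
      exact Or.inr (Or.inr (Or.inl ⟨rfl, rfl⟩))
    · rw [glueOther_legL_of_ne hx] at hzz'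
      obtain ⟨x', hx', rfl⟩ := Option.map_eq_some_iff.1 hzz'
      exact Or.inl ⟨x.1, x'.1, rfl, rfl, adj_iff.2 ⟨x, x', hx', rfl, rfl⟩⟩
  · by_cases hy : y = b
    · subst hy
      rw [glueOther_legR_self] at hzz'
      cases hzz'
      exact Or.inr (Or.inr (Or.inr ⟨rfl, rfl⟩))
    · rw [glueOther_legR_of_ne hy] at hzz'
      obtain ⟨y', hy', rfl⟩ := Option.map_eq_some_iff.1 hzz'
      exact Or.inr (Or.inl ⟨y.1, y'.1, rfl, rfl, adj_iff.2 ⟨y, y', hy', rfl, rfl⟩⟩)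

/-- kernel: paths of the first piece persist. [cite: Balaban1983Higgs3, (1.21) p.416] -/
theorem reflTransGen_glue_left {i i' : Fin G₁.nV} (h : ReflTransGen (Adj G₁) i i') :
    ReflTransGen (Adj (glue G₁ G₂ a b ha hb hab)) (Fin.castAdd G₂.nV i) (Fin.castAdd G₂.nV i') := by
  induction h with
  | refl => exact ReflTransGen.refl
  | tail _ hcd ih => exact ih.tail (adj_glue_left hcd)

/-- kernel: paths of the second piece persist. [cite: Balaban1983Higgs3, (1.21) p.416] -/
theorem reflTransGen_glue_right {j j' : Fin G₂.nV} (h : ReflTransGen (Adj G₂) j j') :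
    ReflTransGen (Adj (glue G₁ G₂ a b ha hb hab)) (Fin.natAdd G₁.nV j) (Fin.natAdd G₁.nV j') := by
  induction h with
  | refl => exact ReflTransGen.refl
  | tail _ hcd ih => exact ih.tail (adj_glue_right hcd)

/-- **gluing connected pieces gives a connected graph** (every vertex is joined to the vertex of `a`, through the new line if
it lies in the second piece). [cite: Balaban1983Higgs3, p.415] -/
theorem isConnected_glue (h₁ : IsConnected G₁) (h₂ : IsConnected G₂) : IsConnected (glue G₁ G₂ a b ha hb hab) := by
  apply isConnected_of_root (Fin.castAdd G₂.nV a.1)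
  intro v
  induction v using Fin.addCases with
  | left i => exact reflTransGen_glue_left (h₁ a.1 i)
  | right j => exact (ReflTransGen.single adj_glue_new).trans (reflTransGen_glue_right (h₂ b.1 j))

/-- kernel (projection onto the first piece): collapsing the second piece to the vertex of `a` maps adjacent vertices of the
glued graph to equal or adjacent vertices of `G₁`. [cite: Balaban1983Higgs3, p.415] -/
theorem proj_left_adj {v w : Fin (G₁.nV + G₂.nV)} (h : Adj (glue G₁ G₂ a b ha hb hab) v w) :
    ReflTransGen (Adj G₁) (Fin.addCases (fun i => i) (fun _ => a.1) v) (Fin.addCases (fun i => i) (fun _ => a.1) w) := by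
  rcases adj_glue_cases h with ⟨i, i', rfl, rfl, hi⟩ | ⟨j, j', rfl, rfl, -⟩ | ⟨rfl, rfl⟩ | ⟨rfl, rfl⟩
  · simpa using ReflTransGen.single hi
  all_goals simp only [Fin.addCases_left, Fin.addCases_right]; exact ReflTransGen.refl

/-- kernel (projection onto the second piece). [cite: Balaban1983Higgs3, p.415] -/
theorem proj_right_adj {v w : Fin (G₁.nV + G₂.nV)} (h : Adj (glue G₁ G₂ a b ha hb hab) v w) :
    ReflTransGen (Adj G₂) (Fin.addCases (fun _ => b.1) (fun j => j) v) (Fin.addCases (fun _ => b.1) (fun j => j) w) := by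
  rcases adj_glue_cases h with ⟨i, i', rfl, rfl, -⟩ | ⟨j, j', rfl, rfl, hj⟩ | ⟨rfl, rfl⟩ | ⟨rfl, rfl⟩
  · simp only [Fin.addCases_left]; exact ReflTransGen.refl
  · simpa using ReflTransGen.single hj
  all_goals simp only [Fin.addCases_left, Fin.addCases_right]; exact ReflTransGen.refl

/-- **conversely, the first piece of a connected glued graph is connected** (project a path of the glued graph onto `G₁`).
[cite: Balaban1983Higgs3, p.415] -/
theorem isConnected_of_glue_left (h : IsConnected (glue G₁ G₂ a b ha hb hab)) : IsConnected G₁ := by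
  intro i i'
  have hp := h (Fin.castAdd G₂.nV i) (Fin.castAdd G₂.nV i')
  have key : ∀ {v w}, ReflTransGen (Adj (glue G₁ G₂ a b ha hb hab)) v w →
      ReflTransGen (Adj G₁) (Fin.addCases (fun i => i) (fun _ => a.1) v) (Fin.addCases (fun i => i) (fun _ => a.1) w) := by
    intro v w hvw
    induction hvw with
    | refl => exact ReflTransGen.refl
    | tail _ hcd ih => exact ih.trans (proj_left_adj hcd)
  simpa using key hp

/-- **… and so is the second piece.** [cite: Balaban1983Higgs3, p.415] -/
theorem isConnected_of_glue_right (h : IsConnected (glue G₁ G₂ a b ha hb hab)) : IsConnected G₂ := by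
  intro j j'
  have hp := h (Fin.natAdd G₁.nV j) (Fin.natAdd G₁.nV j')
  have key : ∀ {v w}, ReflTransGen (Adj (glue G₁ G₂ a b ha hb hab)) v w →
      ReflTransGen (Adj G₂) (Fin.addCases (fun _ => b.1) (fun j => j) v) (Fin.addCases (fun _ => b.1) (fun j => j) w) := by
    intro v w hvw
    induction hvw with
    | refl => exact ReflTransGen.refl
    | tail _ hcd ih => exact ih.trans (proj_right_adj hcd)
  simpa using key hp

/-- **the glued graph is connected iff both pieces are.** [cite: Balaban1983Higgs3, p.415] -/
theorem isConnected_glue_iff : IsConnected (glue G₁ G₂ a b ha hb hab) ↔ IsConnected G₁ ∧ IsConnected G₂ :=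
  ⟨fun h => ⟨isConnected_of_glue_left h, isConnected_of_glue_right h⟩, fun h => isConnected_glue h.1 h.2⟩

/-- kernel: after CUTTING the new line, every remaining adjacency stays inside one piece — the vertex set of the first piece
(`v < G₁.nV`) is closed. [cite: Balaban1983Higgs3, (1.21) p.416] -/
theorem adjOff_glue_closed {v w : Fin (G₁.nV + G₂.nV)}
    (h : AdjOff (glue G₁ G₂ a b ha hb hab) (legL G₁.kind G₂.kind a) v w) (hv : (v : ℕ) < G₁.nV) : (w : ℕ) < G₁.nV := by
  obtain ⟨z, z', hzz', hza, -, rfl, rfl⟩ := adjOffOf_iff.1 h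
  rw [glue_other] at hzz'
  rcases exists_legL_or_legR G₁.kind G₂.kind z with ⟨x, rfl⟩ | ⟨y, rfl⟩
  · have hx : x ≠ a := by rintro rfl; exact hza rfl
    rw [glueOther_legL_of_ne hx] at hzz'
    obtain ⟨x', -, rfl⟩ := Option.map_eq_some_iff.1 hzz'
    simp
  · exfalso
    simp at hv

/-- **the new line separates the two pieces**: after cutting it, no path leads from a vertex of the first piece to a vertex of
the second. [cite: Balaban1983Higgs3, (1.21) p.416] -/
theorem not_reflTransGen_adjOff_glue (i : Fin G₁.nV) (j : Fin G₂.nV) :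
    ¬ ReflTransGen (AdjOff (glue G₁ G₂ a b ha hb hab) (legL G₁.kind G₂.kind a))
      (Fin.castAdd G₂.nV i) (Fin.natAdd G₁.nV j) :=
  not_reflTransGen_of_closed (fun v : Fin (G₁.nV + G₂.nV) => (v : ℕ) < G₁.nV) (fun _ _ hv hvw => adjOff_glue_closed hvw hv)
    (by simp) (by simp)

/-- **the glued graph does not stay connected after cutting the new line.** [cite: Balaban1983Higgs3, (1.21) p.416] -/
theorem not_isConnectedOff_glue : ¬ IsConnectedOff (glue G₁ G₂ a b ha hb hab) (legL G₁.kind G₂.kind a) :=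
  fun h => not_reflTransGen_adjOff_glue a.1 b.1 (h _ _)

/-- **a glued graph is one-particle REDUCIBLE** (the new line is internal and separating) — the model side of: a term of
C₀^ε[X C₀^ε]ⁿ with n ≥ 2 insertions is not a 1PI graph. [cite: Balaban1983Higgs3, (1.21) p.416] -/
theorem not_isOnePI_glue : ¬ IsOnePI (glue G₁ G₂ a b ha hb hab) :=
  fun h => not_isConnectedOff_glue (h.2 (legL G₁.kind G₂.kind a) (by simp))

/-- kernel: an external leg of the first piece other than `a` stays external in the glued graph.
[cite: Balaban1983Higgs3, (1.21) p.416] -/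
theorem glue_other_legL_eq_none {x : Leg G₁.kind} (hx : x ≠ a) (hxe : G₁.other x = none) :
    (glue G₁ G₂ a b ha hb hab).other (legL G₁.kind G₂.kind x) = none := by
  simp [glueOther_legL_of_ne hx, hxe]

/-- kernel: an external leg of the second piece other than `b` stays external in the glued graph.
[cite: Balaban1983Higgs3, (1.21) p.416] -/
theorem glue_other_legR_eq_none {y : Leg G₂.kind} (hy : y ≠ b) (hye : G₂.other y = none) :
    (glue G₁ G₂ a b ha hb hab).other (legR G₁.kind G₂.kind y) = none := by
  simp [glueOther_legR_of_ne hy, hye]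

/-- **not proper**: if the first piece keeps an external leg `x ≠ a` and the second an external leg `y ≠ b`, the new line
separates these two external legs of the glued graph, so the glued graph is not proper (and a fortiori not 1PI).
[cite: Balaban1983Higgs3, (1.21) p.416] -/
theorem not_isProper_glue {x : Leg G₁.kind} (hx : x ≠ a) (hxe : G₁.other x = none) {y : Leg G₂.kind} (hy : y ≠ b)
    (hye : G₂.other y = none) : ¬ IsProper (glue G₁ G₂ a b ha hb hab) := by
  intro h
  have := h.2 (legL G₁.kind G₂.kind a) (by simp) (legL G₁.kind G₂.kind x) (legR G₁.kind G₂.kind y)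
    (glue_other_legL_eq_none hx hxe) (glue_other_legR_eq_none hy hye)
  exact not_reflTransGen_adjOff_glue x.1 y.1 this

/-! ## §5 External legs of the glued graph: all the old ones except `a` and `b` -/

/-- kernel: the external legs of the glued graph are the external legs `≠ a` of the first piece and the external legs `≠ b`
of the second, embedded. [cite: Balaban1983Higgs3, (1.21) p.416] -/
theorem filter_glue_other_eq_none :
    (Finset.univ.filter fun z : Leg (glue G₁ G₂ a b ha hb hab).kind => (glue G₁ G₂ a b ha hb hab).other z = none) =
      ((Finset.univ.filter fun x : Leg G₁.kind => x ≠ a ∧ G₁.other x = none).map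
          ⟨legL G₁.kind G₂.kind, legL_injective G₁.kind G₂.kind⟩) ∪
      ((Finset.univ.filter fun y : Leg G₂.kind => y ≠ b ∧ G₂.other y = none).map
          ⟨legR G₁.kind G₂.kind, legR_injective G₁.kind G₂.kind⟩) := by
  ext z
  simp only [Finset.mem_filter, Finset.mem_univ, true_and, Finset.mem_union, Finset.mem_map,
    Function.Embedding.coeFn_mk]
  constructor
  · intro hz
    rcases exists_legL_or_legR G₁.kind G₂.kind z with ⟨x, rfl⟩ | ⟨y, rfl⟩
    · have hx : x ≠ a := by rintro rfl; simp at hz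
      refine Or.inl ⟨x, ⟨hx, ?_⟩, rfl⟩
      rw [glueOther_legL_of_ne hx] at hz
      cases h : G₁.other x with
      | none => rfl
      | some x' => rw [h] at hz; simp at hz
    · have hy : y ≠ b := by rintro rfl; simp at hz
      refine Or.inr ⟨y, ⟨hy, ?_⟩, rfl⟩
      rw [glueOther_legR_of_ne hy] at hz
      cases h : G₂.other y with
      | none => rfl
      | some y' => rw [h] at hz; simp at hz
  · rintro (⟨x, ⟨hx, hxe⟩, rfl⟩ | ⟨y, ⟨hy, hye⟩, rfl⟩)
    · simp [glueOther_legL_of_ne hx, hxe]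
    · simp [glueOther_legR_of_ne hy, hye]

/-- kernel: removing the (external) leg `a` from the external legs of `G₁` lowers their number by one.
[cite: Balaban1983Higgs3, (2.17) p.429] -/
theorem card_filter_ne_and_eq_none (G : Graph nbar) (a : Leg G.kind) (ha : G.other a = none) :
    (Finset.univ.filter fun x : Leg G.kind => x ≠ a ∧ G.other x = none).card + 1 =
      (Finset.univ.filter fun x : Leg G.kind => G.other x = none).card := by
  have hmem : a ∈ Finset.univ.filter fun x : Leg G.kind => G.other x = none := by simp [ha]
  have hEq : (Finset.univ.filter fun x : Leg G.kind => x ≠ a ∧ G.other x = none) =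
      (Finset.univ.filter fun x : Leg G.kind => G.other x = none).erase a := by
    ext x; simp
  rw [hEq, Finset.card_erase_of_mem hmem]
  have := Finset.card_pos.2 ⟨a, hmem⟩
  omega

/-- **the glued graph has all the external legs of the two pieces except `a` and `b`**:
`numExtLegs (glue G₁ G₂ a b …) + 2 = numExtLegs G₁ + numExtLegs G₂` (so two-leg pieces glue to a two-leg graph).
[cite: Balaban1983Higgs3, (1.21) p.416] -/
theorem numExtLegs_glue : (glue G₁ G₂ a b ha hb hab).numExtLegs + 2 = G₁.numExtLegs + G₂.numExtLegs := by
  rw [Graph.numExtLegs_eq_card, Graph.numExtLegs_eq_card, Graph.numExtLegs_eq_card, filter_glue_other_eq_none,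
    Finset.card_union_of_disjoint, Finset.card_map, Finset.card_map,
    ← card_filter_ne_and_eq_none G₁ a ha, ← card_filter_ne_and_eq_none G₂ b hb]
  · omega
  · rw [Finset.disjoint_left]
    rintro z hz₁ hz₂
    simp only [Finset.mem_map, Function.Embedding.coeFn_mk] at hz₁ hz₂
    obtain ⟨x, -, rfl⟩ := hz₁
    obtain ⟨y, -, h⟩ := hz₂
    exact legL_ne_legR _ _ x y h.symm

end Glue

end Literature.MathematicalPhysics.QuantumFieldTheory.Balaban1983to89.B3GraphGlue
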